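import Mathlib
import Literature.Barriers.Parity.FordMaynardPrimeSieves
import Literature.NumberTheory.Sieve.FriedlanderIwaniecPrimesThresholdSeparation

/-!
# Route `FordMaynardSieveConst01651`, target `SieveConst01651` (stmt-Parity-19185), line `sieve_decomposition`:
# helpers towards `stub_typeIIRegion` — Ford–Maynard's Type-II information (II) as a `BilinBoundedBy` statement

Ford–Maynard (arXiv:2407.14368v1) remove the entangling conditions of §7.3 (Lemma 7.9 "separation of variables
in inequalities", Lemma 7.13 "removing box conditions", the twists `n ↦ n^{it}` absorbed into `1`-bounded
coefficients) before invoking the Type-II bound (II).  The tree already PROVES these devices, for bilinear forms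
with `1`-bounded coefficients, as transformers of the predicate
`Literature.NumberTheory.Sieve.FriedlanderIwaniecPrimes.BilinBoundedBy K W Z X`
(`.threshold` — a threshold condition `[B(w) < A(z)]` costs `3(1 + log R)`; `.cutoff` — a product cutoff
`[u(w) v(z) ≤ y]` costs `log 6y`; `.bvWeight`, `.twist`, `.coprime`, `.sum`, `.add`, …;
`Literature/NumberTheory/Sieve/FriedlanderIwaniecPrimes{Threshold,Cutoff}Separation.lean`).
This file is the ADAPTER: the tree's `FordMaynard.TypeII w x θ ν B` (coefficients bounded by `τ^B`) yields
`BilinBoundedBy` for the kernel `K(m, n) = τ(m)^{B'} τ(n)^{B'} 𝟙[x/2 < mn ≤ x] w(mn)` on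
`W = {(x/2)^θ < m ≤ x^{θ+ν}}`, `Z = [1, x]`, for every `B' ≤ B` (`bilinBoundedBy_of_typeII`), in particular
for the plain kernel `𝟙[x/2 < mn ≤ x] w(mn)` (`bilinBoundedBy_of_typeII_zero`) — so that the separation lemmas
of §7.3 can be discharged by the tree's transformers and the result fed back through
`typeII_tuple_sum_bound` (…TypeIIEnd) / (II).
Def-free. Nothing here proves anything about the Parity summit.
-/

open Finset

namespace Summit.Parity.GeneralizedHardyLittlewood.FordMaynardSieveConst01651SieveConst01651

/-- **(II) ⇒ `BilinBoundedBy`, divisor-power class.** If `w` satisfies Ford–Maynard's Type-II bound on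
`((x/2)^θ, x^{θ+ν}]` with exponent `B`, then for `B' ≤ B` every bilinear form
`∑_{(x/2)^θ < m ≤ x^{θ+ν}} ∑_{n ≤ x} a(m) b(n) τ(m)^{B'} τ(n)^{B'} 𝟙[x/2 < mn ≤ x] w(mn)` with `|a|, |b| ≤ 1` has
norm `≤ x/(log x)^B` (any real `B' ≤ B`; `τ ≥ 1` on the ranges) — i.e. (II) restated on the tree's `BilinBoundedBy` (Friedlander–Iwaniec (21.13) shape),
to which the tree's separation transformers (`.threshold`, `.cutoff`, `.twist`, …) apply.
[cite: FordMaynard2024PrimeSieves, §1 (II) and §7.3 (use of (II) after Lemmas 7.9, 7.13)] -/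
theorem bilinBoundedBy_of_typeII {w : ℕ → ℝ} {x θ ν B : ℝ}
    (hII : Literature.Barriers.Parity.FordMaynard.TypeII w x θ ν B) {B' : ℝ} (hB'B : B' ≤ B) :
    Literature.NumberTheory.Sieve.FriedlanderIwaniecPrimes.BilinBoundedBy
      (fun m n : ℕ => ((m.divisors.card : ℝ) ^ B' : ℝ) * ((n.divisors.card : ℝ) ^ B' : ℝ) *
        (if x / 2 < (m * n : ℝ) ∧ (m * n : ℝ) ≤ x then (w (m * n) : ℂ) else 0))
      ((Icc 1 ⌊x ^ (θ + ν)⌋₊).filter (fun m : ℕ => (x / 2) ^ θ < (m : ℝ))) (Icc 1 ⌊x⌋₊)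
      (x / Real.log x ^ B) := by
  intro a b ha hb
  -- the divisor-power-weighted coefficients (set to `0` at `0`, where `τ(0) = 0`)
  set ξ : ℕ → ℂ := fun m => if m = 0 then 0 else a m * (((m.divisors.card : ℝ) ^ B' : ℝ) : ℂ) with hξ
  set κ : ℕ → ℂ := fun n => if n = 0 then 0 else b n * (((n.divisors.card : ℝ) ^ B' : ℝ) : ℂ) with hκ
  have hτ : ∀ m : ℕ, m ≠ 0 → (1 : ℝ) ≤ (m.divisors.card : ℝ) := fun m hm => by
    exact_mod_cast Finset.card_pos.mpr ⟨1, Nat.one_mem_divisors.mpr hm⟩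
  have hcoef : ∀ (c : ℕ → ℂ), (∀ m, ‖c m‖ ≤ 1) → ∀ m : ℕ,
      ‖(if m = 0 then 0 else c m * (((m.divisors.card : ℝ) ^ B' : ℝ) : ℂ))‖ ≤ (m.divisors.card : ℝ) ^ B := by
    intro c hc m
    split_ifs with hm
    · rw [norm_zero]; exact Real.rpow_nonneg (Nat.cast_nonneg _) _
    · rw [norm_mul, Complex.norm_real, Real.norm_of_nonneg (Real.rpow_nonneg (Nat.cast_nonneg _) _)]
      calc ‖c m‖ * (m.divisors.card : ℝ) ^ B' ≤ 1 * (m.divisors.card : ℝ) ^ B' :=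
            mul_le_mul_of_nonneg_right (hc m) (Real.rpow_nonneg (Nat.cast_nonneg _) _)
        _ ≤ (m.divisors.card : ℝ) ^ B := by
            rw [one_mul]; exact Real.rpow_le_rpow_of_exponent_le (hτ m hm) hB'B
  have h := hII ξ κ (hcoef a ha) (hcoef b hb)
  refine le_of_eq_of_le ?_ h
  congr 1
  refine Finset.sum_congr rfl fun m hm => ?_
  rw [Finset.sum_filter]
  refine Finset.sum_congr rfl fun n hn => ?_
  have hm0 : m ≠ 0 := by
    have := (Finset.mem_Icc.mp (Finset.mem_filter.mp hm).1).1; omega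
  have hn0 : n ≠ 0 := by
    have := (Finset.mem_Icc.mp hn).1; omega
  simp only [hξ, hκ, if_neg hm0, if_neg hn0]
  split_ifs with hw
  · ring
  · simp

/-- **(II) ⇒ `BilinBoundedBy`, plain kernel** (`B' = 0`): every bilinear form
`∑_{(x/2)^θ < m ≤ x^{θ+ν}} ∑_{n ≤ x} a(m) b(n) 𝟙[x/2 < mn ≤ x] w(mn)` with `|a|, |b| ≤ 1` is `≤ x/(log x)^B`
(`B ≥ 0`). [cite: FordMaynard2024PrimeSieves, §1 (II)] -/
theorem bilinBoundedBy_of_typeII_zero {w : ℕ → ℝ} {x θ ν B : ℝ}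
    (hII : Literature.Barriers.Parity.FordMaynard.TypeII w x θ ν B) (hB : 0 ≤ B) :
    Literature.NumberTheory.Sieve.FriedlanderIwaniecPrimes.BilinBoundedBy
      (fun m n : ℕ => (if x / 2 < (m * n : ℝ) ∧ (m * n : ℝ) ≤ x then (w (m * n) : ℂ) else 0))
      ((Icc 1 ⌊x ^ (θ + ν)⌋₊).filter (fun m : ℕ => (x / 2) ^ θ < (m : ℝ))) (Icc 1 ⌊x⌋₊)
      (x / Real.log x ^ B) := by
  have h := bilinBoundedBy_of_typeII hII hB
  intro a b ha hb
  refine le_of_eq_of_le ?_ (h a b ha hb)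
  congr 1
  refine Finset.sum_congr rfl fun m _ => Finset.sum_congr rfl fun n _ => ?_
  simp only [Real.rpow_zero, Complex.ofReal_one, one_mul]

end Summit.Parity.GeneralizedHardyLittlewood.FordMaynardSieveConst01651SieveConst01651
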